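import Literature.Computability.Complexity.CHCounting
import Literature.Computability.Complexity.StackBricksArith
import Literature.Computability.Complexity.ListFoldBricks
import HarnessLib

/-!
# Functions with a graph in the counting hierarchy: atoms and substitution

Second toolkit file (theorems only) of the scaled-up `FOM + MAJ` calculus behind Bürgisser's
"integers definable in `CH`" (ECCC TR06-113, §3) and the Hesse–Allender–Barrington arithmetic
(JCSS 65 (2002), §3–4). A number-valued function of strings `f : List Bool → ℕ` of polynomial
bit-size is handled through its **graph language** `{⟨x, ν⟩ | f x = val ν}` (total projections
`fstP`/`sndP`, numerals read by `bitsToNat`); this file provides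

* polynomial-time atoms: the graphs of the arithmetic bricks (`=`, `<`, `+`, `∸`, `·`, `/`,
  `mod` on numerals) are in `P` (`eqVal_mem_P`, `ltVal_mem_P`, `graphFP_mem_P`, `addGraph_mem_P`,
  …), and every `FP` string function has values below `2^{poly}` (`exists_val_lt_of_mem_FP`);
* the **substitution rule** `rel_apply_mem_CH`: if `R ∈ CH`, `f` has a `CH` graph and
  polynomial bit-size, and `g ∈ FP`, then `{w | ⟨bin (f (g w)), w⟩ ∈ R} ∈ CH` — first-order
  substitution of a `CH`-definable term into a `CH`-definable formula (`∃ v < 2^{p}`, graph, and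
  the bounded quantifier of `CHCounting.lean`);
* its instances: thresholds and bits of `f` (`gtGraph_mem_CH`, `ltGraph_mem_CH`,
  `testBitGraph_mem_CH`), composition with unary and binary `CH`-graph operations
  (`comp₁_graph_mem_CH`, `comp₂_graph_mem_CH`), and definition by cases (`iteGraph_mem_CH`).

Allender–Wagner 1993, §3 / Torán 1991, §4 phrase this as "`CH` is closed under `FO + MAJ`
definitions"; Bürgisser 2006, §2.1–3 uses exactly these manipulations ("by bisecting according to
the following oracle in `Σ₂`", "computable in `CH`"). No new definitions.

## References

* P. Bürgisser, ECCC TR06-113 (2006), §2.1, §3 (proof of Thm. 3.7).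
* J. Torán, J. ACM 38 (1991), §4.
* E. Allender, K. W. Wagner, *Counting hierarchies: polynomial time and constant depth circuits*,
  in: Current Trends in Theoretical Computer Science (1993), §3.
-/

namespace Literature.Computability.Complexity

open _root_.Computability Polynomial PRelSigma TTClosure Brick PPSharpP ThresholdPP

/-! ### Polynomial-time atoms -/

/-- A language decided by a one-bit `FP` test is in `P`. [cite: AroraBarak2009, Def. 1.13] -/
theorem setOf_mem_P_of_decide {g : List Bool → List Bool} (hg : g ∈ FP) (Q : List Bool → Prop)
    [DecidablePred Q] (h : ∀ w, g w = [decide (Q w)]) : ({w | Q w} : Language Bool) ∈ Classes.P :=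
  mem_P_of_mem_FP hg _ fun w =>
    ⟨fun hw => by rw [h, decide_eq_true (show Q w from hw)],
     fun hw => by rw [h, decide_eq_false (show ¬ Q w from hw)]⟩

/-- `ltFn` on an arbitrary string, through the projections. [folklore] -/
theorem ltFn_apply (u : List Bool) : ltFn u = [decide (bitsToNat (fstP u) < bitsToNat (sndP u))] := rfl

/-- **`{⟨a, b⟩ | val a < val b} ∈ P`.** [folklore] -/
theorem ltVal_mem_P : ({u | bitsToNat (fstP u) < bitsToNat (sndP u)} : Language Bool) ∈ Classes.P :=
  setOf_mem_P_of_decide ltFn_mem_FP _ ltFn_apply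

/-- **`{⟨a, b⟩ | val b < val a} ∈ P`.** [folklore] -/
theorem gtVal_mem_P : ({u | bitsToNat (sndP u) < bitsToNat (fstP u)} : Language Bool) ∈ Classes.P := by
  refine setOf_mem_P_of_decide (comp_mem_FP ltFn_mem_FP (pairFn_mem_FP sndP_mem_FP fstP_mem_FP)) _ fun w => ?_
  simp only [Function.comp_apply, pairFn_apply, ltFn_boolPair]

/-- **`{⟨a, b⟩ | val a = val b} ∈ P`.** [folklore] -/
theorem eqVal_mem_P : ({u | bitsToNat (fstP u) = bitsToNat (sndP u)} : Language Bool) ∈ Classes.P := by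
  refine mem_P_of_iff (inter_mem_P ((compl_mem_P_iff).2 ltVal_mem_P) ((compl_mem_P_iff).2 gtVal_mem_P)) _
    fun u => ?_
  rw [memL_inf', memL_compl, memL_compl]
  change bitsToNat (fstP u) = bitsToNat (sndP u) ↔
    ¬ bitsToNat (fstP u) < bitsToNat (sndP u) ∧ ¬ bitsToNat (sndP u) < bitsToNat (fstP u)
  omega

/-- **`{⟨a, b⟩ | val a ≤ val b} ∈ P`.** [folklore] -/
theorem leVal_mem_P : ({u | bitsToNat (fstP u) ≤ bitsToNat (sndP u)} : Language Bool) ∈ Classes.P := by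
  refine mem_P_of_iff ((compl_mem_P_iff).2 gtVal_mem_P) _ fun u => ?_
  rw [memL_compl]
  change bitsToNat (fstP u) ≤ bitsToNat (sndP u) ↔ ¬ bitsToNat (sndP u) < bitsToNat (fstP u)
  omega

/-- **The graph of the value of an `FP` string function is in `P`**:
`{⟨x, ν⟩ | val (g x) = val ν} ∈ P` for `g ∈ FP`. [cite: AroraBarak2009, Def. 1.13] -/
theorem graphFP_mem_P {g : List Bool → List Bool} (hg : g ∈ FP) :
    ({z | bitsToNat (g (fstP z)) = bitsToNat (sndP z)} : Language Bool) ∈ Classes.P :=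
  mem_P_of_iff (preimage_mem_P eqVal_mem_P (pairFn_mem_FP (comp_mem_FP hg fstP_mem_FP) sndP_mem_FP)) _
    fun z => by
      change _ ↔ bitsToNat (fstP (pairFn (g ∘ fstP) sndP z)) = bitsToNat (sndP (pairFn (g ∘ fstP) sndP z))
      rw [pairFn_apply, fstP_boolPair, sndP_boolPair]
      rfl

/-- **Values of `FP` functions have polynomial bit-size**: `val (g w) < 2^{s(|w|)}`. [cite: AroraBarak2009, §1.3] -/
theorem exists_val_lt_of_mem_FP {g : List Bool → List Bool} (hg : g ∈ FP) :
    ∃ s : Polynomial ℕ, ∀ w, bitsToNat (g w) < 2 ^ s.eval w.length := by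
  obtain ⟨s, hs⟩ := exists_poly_length_le_of_mem_FP hg
  exact ⟨s, fun w => (bitsToNat_lt _).trans_le (Nat.pow_le_pow_right (by norm_num) (hs w))⟩

/-- The graph of addition `{⟨⟨a, b⟩, c⟩ | val a + val b = val c}` is in `P`. [folklore] -/
theorem addGraph_mem_P :
    ({u | bitsToNat (fstP (fstP u)) + bitsToNat (sndP (fstP u)) = bitsToNat (sndP u)} : Language Bool) ∈
      Classes.P :=
  mem_P_of_iff (graphFP_mem_P addFn_mem_FP) _ fun u => by
    change _ ↔ bitsToNat (addFn (fstP u)) = bitsToNat (sndP u)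
    rw [addFn, bitsToNat_encodeNat]; rfl

/-- The graph of truncated subtraction `{⟨⟨a, b⟩, c⟩ | val a ∸ val b = val c}` is in `P`. [folklore] -/
theorem subGraph_mem_P :
    ({u | bitsToNat (fstP (fstP u)) - bitsToNat (sndP (fstP u)) = bitsToNat (sndP u)} : Language Bool) ∈
      Classes.P :=
  mem_P_of_iff (graphFP_mem_P subFn_mem_FP) _ fun u => by
    change _ ↔ bitsToNat (subFn (fstP u)) = bitsToNat (sndP u)
    rw [subFn, bitsToNat_encodeNat]; rfl

/-- The graph of multiplication `{⟨⟨a, b⟩, c⟩ | val a · val b = val c}` is in `P`. [folklore] -/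
theorem mulGraph_mem_P :
    ({u | bitsToNat (fstP (fstP u)) * bitsToNat (sndP (fstP u)) = bitsToNat (sndP u)} : Language Bool) ∈
      Classes.P :=
  mem_P_of_iff (graphFP_mem_P prodFn_mem_FP) _ fun u => by
    change _ ↔ bitsToNat (prodFn (fstP u)) = bitsToNat (sndP u)
    rw [prodFn, bitsToNat_encodeNat]; rfl

/-- The graph of the remainder `{⟨⟨a, b⟩, c⟩ | val a mod val b = val c}` is in `P`. [folklore] -/
theorem modGraph_mem_P :
    ({u | bitsToNat (fstP (fstP u)) % bitsToNat (sndP (fstP u)) = bitsToNat (sndP u)} : Language Bool) ∈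
      Classes.P :=
  mem_P_of_iff (graphFP_mem_P remFn_mem_FP) _ fun u => by
    change _ ↔ bitsToNat (remFn (fstP u)) = bitsToNat (sndP u)
    rw [remFn, bitsToNat_encodeNat]; rfl

/-- The graph of the quotient `{⟨⟨a, b⟩, c⟩ | val a / val b = val c}` is in `P`. [folklore] -/
theorem divGraph_mem_P :
    ({u | bitsToNat (fstP (fstP u)) / bitsToNat (sndP (fstP u)) = bitsToNat (sndP u)} : Language Bool) ∈
      Classes.P :=
  mem_P_of_iff (graphFP_mem_P divFn_mem_FP) _ fun u => by
    change _ ↔ bitsToNat (divFn (fstP u)) = bitsToNat (sndP u)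
    rw [divFn, bitsToNat_encodeNat]; rfl

/-! ### The substitution rule -/

section Subst

variable {f : List Bool → ℕ} {p : Polynomial ℕ}

/-- **Substitution of a `CH`-definable term into a `CH` formula.** If `R ∈ CH`, the graph
`{⟨x, ν⟩ | f x = val ν}` of `f` is in `CH`, `f w < 2^{p(|w|)}`, and `g ∈ FP`, then
`{w | ⟨bin (f (g w)), w⟩ ∈ R} ∈ CH`: it is `{w | ∃ v < 2^{p(s|w|)}, f (g w) = v ∧ ⟨bin v, w⟩ ∈ R}`
with `|g w| ≤ s(|w|)` (Torán 1991, §4; the step "compute … in `CH`, then …" of Bürgisser 2006,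
proof of Thm. 3.7). [cite: Toran1991, §4] -/
theorem rel_apply_mem_CH {R : Language Bool} (hR : R ∈ CH)
    (hf : {z | f (fstP z) = bitsToNat (sndP z)} ∈ CH) (hb : ∀ w, f w < 2 ^ p.eval w.length)
    {g : List Bool → List Bool} (hg : g ∈ FP) :
    {w | boolPair (encodeNat (f (g w))) w ∈ R} ∈ CH := by
  obtain ⟨s, hs⟩ := exists_poly_length_le_of_mem_FP hg
  have hI : (pairFn (g ∘ fstP) sndP ⁻¹' {z | f (fstP z) = bitsToNat (sndP z)}) ⊓ (pairFn sndP fstP ⁻¹' R) ∈ CH :=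
    inter_mem_CH (preimage_mem_CH hf (pairFn_mem_FP (comp_mem_FP hg fstP_mem_FP) sndP_mem_FP))
      (preimage_mem_CH hR (pairFn_mem_FP sndP_mem_FP fstP_mem_FP))
  refine mem_CH_of_iff (exists_lt_mem_CH hI (p.comp s)) _ fun w => ?_
  change boolPair (encodeNat (f (g w))) w ∈ R ↔ ∃ v < 2 ^ (p.comp s).eval w.length,
    f (fstP (pairFn (g ∘ fstP) sndP (boolPair w (encodeNat v)))) =
        bitsToNat (sndP (pairFn (g ∘ fstP) sndP (boolPair w (encodeNat v)))) ∧
      pairFn sndP fstP (boolPair w (encodeNat v)) ∈ R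
  simp only [pairFn_apply, Function.comp_apply, fstP_boolPair, sndP_boolPair, bitsToNat_encodeNat, eval_comp]
  constructor
  · intro h
    exact ⟨f (g w), (hb (g w)).trans_le (Nat.pow_le_pow_right (by norm_num) (TM2Iter.eval_mono p (hs w))),
      rfl, h⟩
  · rintro ⟨v, -, hv, h⟩
    rwa [hv]

/-- **Thresholds of a `CH`-graph function**: `{⟨x, ν⟩ | val ν < f x} ∈ CH`. [cite: Toran1991, §4] -/
theorem gtGraph_mem_CH (hf : {z | f (fstP z) = bitsToNat (sndP z)} ∈ CH) (hb : ∀ w, f w < 2 ^ p.eval w.length) :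
    {z | bitsToNat (sndP z) < f (fstP z)} ∈ CH := by
  refine mem_CH_of_iff (rel_apply_mem_CH (P_subset_CH (preimage_mem_P gtVal_mem_P
    (pairFn_mem_FP fstP_mem_FP (comp_mem_FP sndP_mem_FP sndP_mem_FP)))) hf hb fstP_mem_FP) _ fun z => ?_
  change _ ↔ bitsToNat (sndP (pairFn fstP (sndP ∘ sndP) (boolPair (encodeNat (f (fstP z))) z))) <
    bitsToNat (fstP (pairFn fstP (sndP ∘ sndP) (boolPair (encodeNat (f (fstP z))) z)))
  simp only [pairFn_apply, Function.comp_apply, fstP_boolPair, sndP_boolPair, bitsToNat_encodeNat]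
  rfl

/-- `{⟨x, ν⟩ | f x < val ν} ∈ CH`. [cite: Toran1991, §4] -/
theorem ltGraph_mem_CH (hf : {z | f (fstP z) = bitsToNat (sndP z)} ∈ CH) (hb : ∀ w, f w < 2 ^ p.eval w.length) :
    {z | f (fstP z) < bitsToNat (sndP z)} ∈ CH := by
  refine mem_CH_of_iff (rel_apply_mem_CH (P_subset_CH (preimage_mem_P ltVal_mem_P
    (pairFn_mem_FP fstP_mem_FP (comp_mem_FP sndP_mem_FP sndP_mem_FP)))) hf hb fstP_mem_FP) _ fun z => ?_
  change _ ↔ bitsToNat (fstP (pairFn fstP (sndP ∘ sndP) (boolPair (encodeNat (f (fstP z))) z))) <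
    bitsToNat (sndP (pairFn fstP (sndP ∘ sndP) (boolPair (encodeNat (f (fstP z))) z)))
  simp only [pairFn_apply, Function.comp_apply, fstP_boolPair, sndP_boolPair, bitsToNat_encodeNat]
  rfl

/-- `{⟨x, ν⟩ | f x ≤ val ν} ∈ CH`. [cite: Toran1991, §4] -/
theorem leGraph_mem_CH (hf : {z | f (fstP z) = bitsToNat (sndP z)} ∈ CH) (hb : ∀ w, f w < 2 ^ p.eval w.length) :
    {z | f (fstP z) ≤ bitsToNat (sndP z)} ∈ CH := by
  refine mem_CH_of_iff (compl_mem_CH (gtGraph_mem_CH hf hb)) _ fun z => ?_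
  rw [memL_compl]
  change f (fstP z) ≤ bitsToNat (sndP z) ↔ ¬ bitsToNat (sndP z) < f (fstP z)
  omega

/-- `{⟨x, ν⟩ | val ν ≤ f x} ∈ CH`. [cite: Toran1991, §4] -/
theorem geGraph_mem_CH (hf : {z | f (fstP z) = bitsToNat (sndP z)} ∈ CH) (hb : ∀ w, f w < 2 ^ p.eval w.length) :
    {z | bitsToNat (sndP z) ≤ f (fstP z)} ∈ CH := by
  refine mem_CH_of_iff (compl_mem_CH (ltGraph_mem_CH hf hb)) _ fun z => ?_
  rw [memL_compl]
  change bitsToNat (sndP z) ≤ f (fstP z) ↔ ¬ f (fstP z) < bitsToNat (sndP z)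
  omega

/-- **Bits of a `CH`-graph function**: `{⟨x, j⟩ | bit (val j) of f x is 1} ∈ CH` — a function of
polynomial bit-size with a `CH` graph is also given bitwise in `CH` (Bürgisser 2006, Def. 3.1 /
Rem. 3.2). [cite: Burgisser2006, Remark 3.2] -/
theorem testBitGraph_mem_CH (hf : {z | f (fstP z) = bitsToNat (sndP z)} ∈ CH)
    (hb : ∀ w, f w < 2 ^ p.eval w.length) :
    {z | (f (fstP z)).testBit (bitsToNat (sndP z)) = true} ∈ CH := by
  refine mem_CH_of_iff (rel_apply_mem_CH (P_subset_CH (preimage_mem_P testBitLang_mem_P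
    (pairFn_mem_FP fstP_mem_FP (comp_mem_FP sndP_mem_FP sndP_mem_FP)))) hf hb fstP_mem_FP) _ fun z => ?_
  change _ ↔ (bitsToNat (fstP (pairFn fstP (sndP ∘ sndP) (boolPair (encodeNat (f (fstP z))) z)))).testBit
    (bitsToNat (sndP (pairFn fstP (sndP ∘ sndP) (boolPair (encodeNat (f (fstP z))) z)))) = true
  simp only [pairFn_apply, Function.comp_apply, fstP_boolPair, sndP_boolPair, bitsToNat_encodeNat]
  rfl

/-! ### Composition with `CH`-graph operations -/

/-- **Unary composition**: if `op : ℕ → ℕ` has a `CH` graph `{⟨a, c⟩ | op (val a) = val c}` and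
`f` has a `CH` graph and polynomial bit-size, then `op ∘ f` has a `CH` graph. [cite: Toran1991, §4] -/
theorem comp₁_graph_mem_CH {op : ℕ → ℕ} (hop : {u | op (bitsToNat (fstP u)) = bitsToNat (sndP u)} ∈ CH)
    (hf : {z | f (fstP z) = bitsToNat (sndP z)} ∈ CH) (hb : ∀ w, f w < 2 ^ p.eval w.length) :
    {z | op (f (fstP z)) = bitsToNat (sndP z)} ∈ CH := by
  refine mem_CH_of_iff (rel_apply_mem_CH (preimage_mem_CH hop
    (pairFn_mem_FP fstP_mem_FP (comp_mem_FP sndP_mem_FP sndP_mem_FP))) hf hb fstP_mem_FP) _ fun z => ?_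
  change _ ↔ op (bitsToNat (fstP (pairFn fstP (sndP ∘ sndP) (boolPair (encodeNat (f (fstP z))) z)))) =
    bitsToNat (sndP (pairFn fstP (sndP ∘ sndP) (boolPair (encodeNat (f (fstP z))) z)))
  simp only [pairFn_apply, Function.comp_apply, fstP_boolPair, sndP_boolPair, bitsToNat_encodeNat]
  rfl

/-- **Binary composition**: if `op : ℕ → ℕ → ℕ` has a `CH` graph
`{⟨⟨a, b⟩, c⟩ | op (val a) (val b) = val c}` and `f₁, f₂` have `CH` graphs and polynomial
bit-size, then `x ↦ op (f₁ x) (f₂ x)` has a `CH` graph (two substitutions). [cite: Toran1991, §4] -/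
theorem comp₂_graph_mem_CH {op : ℕ → ℕ → ℕ} {f₁ f₂ : List Bool → ℕ} {p₁ p₂ : Polynomial ℕ}
    (hop : {u | op (bitsToNat (fstP (fstP u))) (bitsToNat (sndP (fstP u))) = bitsToNat (sndP u)} ∈ CH)
    (hf₁ : {z | f₁ (fstP z) = bitsToNat (sndP z)} ∈ CH) (hb₁ : ∀ w, f₁ w < 2 ^ p₁.eval w.length)
    (hf₂ : {z | f₂ (fstP z) = bitsToNat (sndP z)} ∈ CH) (hb₂ : ∀ w, f₂ w < 2 ^ p₂.eval w.length) :
    {z | op (f₁ (fstP z)) (f₂ (fstP z)) = bitsToNat (sndP z)} ∈ CH := by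
  -- `R₁ = {⟨bin a, ⟨bin b, ⟨x, ν⟩⟩⟩ | op a b = val ν}` as a preimage of the graph of `op`
  have hR₁ : pairFn (pairFn fstP (fstP ∘ sndP)) (sndP ∘ sndP ∘ sndP) ⁻¹'
      {u | op (bitsToNat (fstP (fstP u))) (bitsToNat (sndP (fstP u))) = bitsToNat (sndP u)} ∈ CH :=
    preimage_mem_CH hop (pairFn_mem_FP (pairFn_mem_FP fstP_mem_FP (comp_mem_FP fstP_mem_FP sndP_mem_FP))
      (comp_mem_FP sndP_mem_FP (comp_mem_FP sndP_mem_FP sndP_mem_FP)))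
  -- substitute `f₁` (read off `x = fstP (sndP u')` of `u' = ⟨bin b, ⟨x, ν⟩⟩`)
  have hR₂ := rel_apply_mem_CH hR₁ hf₁ hb₁ (comp_mem_FP fstP_mem_FP sndP_mem_FP)
  -- substitute `f₂` (read off `x = fstP z` of `z = ⟨x, ν⟩`)
  refine mem_CH_of_iff (rel_apply_mem_CH hR₂ hf₂ hb₂ fstP_mem_FP) _ fun z => ?_
  change _ ↔ pairFn (pairFn fstP (fstP ∘ sndP)) (sndP ∘ sndP ∘ sndP)
      (boolPair (encodeNat (f₁ ((fstP ∘ sndP) (boolPair (encodeNat (f₂ (fstP z))) z))))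
        (boolPair (encodeNat (f₂ (fstP z))) z)) ∈
    {u | op (bitsToNat (fstP (fstP u))) (bitsToNat (sndP (fstP u))) = bitsToNat (sndP u)}
  simp only [pairFn_apply, Function.comp_apply, fstP_boolPair, sndP_boolPair]
  change op (f₁ (fstP z)) (f₂ (fstP z)) = bitsToNat (sndP z) ↔
    op (bitsToNat (fstP (fstP (boolPair (boolPair (encodeNat (f₁ (fstP z))) (encodeNat (f₂ (fstP z)))) (sndP z)))))
      (bitsToNat (sndP (fstP (boolPair (boolPair (encodeNat (f₁ (fstP z))) (encodeNat (f₂ (fstP z)))) (sndP z))))) =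
    bitsToNat (sndP (boolPair (boolPair (encodeNat (f₁ (fstP z))) (encodeNat (f₂ (fstP z)))) (sndP z)))
  simp only [fstP_boolPair, sndP_boolPair, bitsToNat_encodeNat]

/-- **Definition by cases**: for `C ∈ CH` and `f, g` with `CH` graphs,
`x ↦ if x ∈ C then f x else g x` has a `CH` graph. [cite: Toran1991, §4] -/
theorem iteGraph_mem_CH {C : Language Bool} [DecidablePred (· ∈ C)] (hC : C ∈ CH) {g : List Bool → ℕ}
    (hf : {z | f (fstP z) = bitsToNat (sndP z)} ∈ CH) (hg : {z | g (fstP z) = bitsToNat (sndP z)} ∈ CH) :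
    {z | (if fstP z ∈ C then f (fstP z) else g (fstP z)) = bitsToNat (sndP z)} ∈ CH := by
  have hC' : fstP ⁻¹' C ∈ CH := preimage_mem_CH hC fstP_mem_FP
  refine mem_CH_of_iff (union_mem_CH (inter_mem_CH hC' hf) (inter_mem_CH (compl_mem_CH hC') hg)) _ fun z => ?_
  rw [memL_sup, memL_inf', memL_inf', memL_compl]
  change (if fstP z ∈ C then f (fstP z) else g (fstP z)) = bitsToNat (sndP z) ↔
    (fstP z ∈ C ∧ f (fstP z) = bitsToNat (sndP z)) ∨ (¬ fstP z ∈ C ∧ g (fstP z) = bitsToNat (sndP z))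
  by_cases h : fstP z ∈ C
  · rw [if_pos h]
    simp only [h, true_and, not_true_eq_false, false_and, or_false]
  · rw [if_neg h]
    simp only [h, false_and, not_false_eq_true, true_and, false_or]

end Subst

/-! ### `CH`-graph functions read at a polynomial-time recoding of the input -/

/-- Precomposition with an `FP` map: the graph of `f ∘ g` is the preimage of the graph of `f`. [folklore] -/
theorem graph_comp_FP_mem_CH {f : List Bool → ℕ} (hf : {z | f (fstP z) = bitsToNat (sndP z)} ∈ CH)
    {g : List Bool → List Bool} (hg : g ∈ FP) :
    {z | f (g (fstP z)) = bitsToNat (sndP z)} ∈ CH :=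
  mem_CH_of_iff (preimage_mem_CH hf (pairFn_mem_FP (comp_mem_FP hg fstP_mem_FP) sndP_mem_FP)) _ fun z => by
    change _ ↔ f (fstP (pairFn (g ∘ fstP) sndP z)) = bitsToNat (sndP (pairFn (g ∘ fstP) sndP z))
    rw [pairFn_apply, fstP_boolPair, sndP_boolPair]
    rfl

/-- The bit-size bound transports along an `FP` map of output length `≤ s`. [folklore] -/
theorem bound_comp_FP {f : List Bool → ℕ} {p s : Polynomial ℕ} (hb : ∀ w, f w < 2 ^ p.eval w.length)
    {g : List Bool → List Bool} (hs : ∀ w, (g w).length ≤ s.eval w.length) :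
    ∀ w, f (g w) < 2 ^ (p.comp s).eval w.length := fun w =>
  (hb (g w)).trans_le (by rw [eval_comp]; exact Nat.pow_le_pow_right (by norm_num) (TM2Iter.eval_mono p (hs w)))

/-- **Graph of the value of an `FP` function is in `CH`** (from `P`). [cite: Burgisser2006, Remark 3.2] -/
theorem graphFP_mem_CH {g : List Bool → List Bool} (hg : g ∈ FP) :
    {z | bitsToNat (g (fstP z)) = bitsToNat (sndP z)} ∈ CH :=
  P_subset_CH (graphFP_mem_P hg)

/-- The identity numeral function `w ↦ val w` has graph in `P` and values `< 2^{|w|}`. [folklore] -/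
theorem graphVal_mem_CH : {z | bitsToNat (fstP z) = bitsToNat (sndP z)} ∈ CH :=
  P_subset_CH eqVal_mem_P

/-- `val w < 2^{|w|}`, in the polynomial form of the toolkit. [folklore] -/
theorem val_lt_two_pow_eval_X (w : List Bool) : bitsToNat w < 2 ^ (X : Polynomial ℕ).eval w.length := by
  rw [eval_X]; exact bitsToNat_lt w

end Literature.Computability.Complexity
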